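import Summits.RiemannHypothesis.RiemannHypothesis.Theses.GroundBarta
import Summits.RiemannHypothesis.RiemannHypothesis.Theorems.GroundBartaGroundBartaFloorBarta
import Summits.RiemannHypothesis.RiemannHypothesis.Theorems.GroundBartaGroundBartaFloorRateDecay
import Summits.RiemannHypothesis.RiemannHypothesis.Theorems.GroundBartaPolarPerronFrobeniusEvenRealGroundState
import HarnessLib

/-!
# The ground Barta floor — THE RUNG of route `RiemannHypothesis/GroundBarta`
(crux `GroundBarta.GroundBartaFloor`, stmt-RiemannHypothesis-18389; line
`outer_cutoff_harmonic_pairing`)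

`GroundBartaFloor_of : Summit.RiemannHypothesis.RiemannHypothesis.Theses.GroundBarta.GroundBartaFloor`:
there are `e → 0` and `a₀` such that at every window `a ≥ a₀` carrying a ground state of the FULL
windowed Weil form (junk-free encoding: `L²`-limit of an `L²`-normalised sequence of smooth window
tests eventually below every normalised window test up to any `δ > 0`) that is real and `≥ 0` a.e.
on `(-a, a)`, every `L²`-normalised smooth test supported in `[-a, a]` has `Re Q ≥ -e(a)`.
Take `e = groundBartaRate` (`e(a) = 2ϖ_a cosh(a/2)/Φ(a) → 0`, `stub_groundRateDecay`) and
`a₀ = 1`: the junk-free clause implies `Re Q(gₙ) → ε(a)` (the sphere of the window is bounded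
below; `PolarPerronFrobenius.forall_eventually_le_iff_tendsto_weilGroundEnergy`, landed for the
sibling crux), so `u` is an `IsWeilGroundState`; the floor at a good
window `ε(a) ≥ -e(a)` is `neg_groundBartaRate_le_weilGroundEnergy` (Barta's inequality through the
outer cut-offs of Riemann's kernel), and `Re Q(h) ≥ ε(a)` on the sphere.  RH-free.
References: Bombieri 2000 §4; Barta 1937 via López-Gómez doi:10.1142/8664 p.175.
-/

set_option linter.dupNamespace false

noncomputable section

open Set MeasureTheory Filter Complex
open scoped Real Topology ComplexConjugate

namespace Summit.RiemannHypothesis.RiemannHypothesis.Theorems.GroundBartaFloor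

open Literature.NumberTheory.LFunctions

/-! ## The crux -/

/-- **The ground Barta floor** (crux `GroundBarta.GroundBartaFloor`, stmt-RiemannHypothesis-18389,
THE RUNG of route GroundBarta): with `e = groundBartaRate` (`→ 0`, `stub_groundRateDecay`) and
`a₀ = 1`, at every window `a ≥ 1` carrying a one-signed bottom state every normalised window test
has `Re Q(h) ≥ ε(a) ≥ -e(a)`. [cite: Bombieri2000Weil, §4 Lemma 1] -/
theorem GroundBartaFloor_of :
    Summit.RiemannHypothesis.RiemannHypothesis.Theses.GroundBarta.GroundBartaFloor := by
  rw [show Summit.RiemannHypothesis.RiemannHypothesis.Theses.GroundBarta.GroundBartaFloor ↔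
      (∃ e : ℝ → ℝ, Tendsto e atTop (nhds 0) ∧ ∃ a₀ : ℝ, ∀ a : ℝ, a₀ ≤ a →
        (∃ u : ℝ → ℂ, (MemLp u 2 ∧ ∃ g : ℕ → ℝ → ℂ,
            (∀ n, IsWeilTest (g n) ∧ tsupport (g n) ⊆ Icc (-a) a ∧ ∫ t, ‖g n t‖ ^ 2 = (1 : ℝ)) ∧
            (∀ h : ℝ → ℂ, IsWeilTest h → tsupport h ⊆ Icc (-a) a → ∫ t, ‖h t‖ ^ 2 = (1 : ℝ) →
              ∀ δ : ℝ, 0 < δ → ∀ᶠ n in atTop, (weilQuadratic (g n)).re ≤ (weilQuadratic h).re + δ) ∧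
            Tendsto (fun n => ∫ t, ‖g n t - u t‖ ^ 2) atTop (nhds 0)) ∧
          (∀ᵐ t : ℝ, t ∈ Ioo (-a) a → (u t).im = 0 ∧ 0 ≤ (u t).re)) →
        ∀ h : ℝ → ℂ, IsWeilTest h → tsupport h ⊆ Icc (-a) a →
          ∫ t, ‖h t‖ ^ 2 = (1 : ℝ) → -e a ≤ (weilQuadratic h).re) from Iff.rfl]
  refine ⟨groundBartaRate, stub_groundRateDecay, 1, fun a ha hgood h hh hs hnorm => ?_⟩
  obtain ⟨u, ⟨hu2, g, hg, hmin, hL⟩, hsign⟩ := hgood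
  have ha0 : 0 < a := one_pos.trans_le ha
  have hu' : IsWeilGroundState a u :=
    ⟨hu2, g, hg, (PolarPerronFrobenius.forall_eventually_le_iff_tendsto_weilGroundEnergy hg).1 hmin,
      hL⟩
  exact (neg_groundBartaRate_le_weilGroundEnergy ha0 hu' hsign).trans
    (PolarPerronFrobenius.weilGroundEnergy_le_of_sphere hh hs hnorm)

end Summit.RiemannHypothesis.RiemannHypothesis.Theorems.GroundBartaFloor

end

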